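import Summits.BirchSwinnertonDyer.BirchSwinnertonDyer.Theorems.TwoAdicConverseBDPAcLineSpecialisationAtTwoControl
import HarnessLib

/-!
# AC-LINE SPECIALISATION₂, the COINVARIANT DOOR (part I-a): inflation–restriction WITH EXPONENT in the COINVARIANT currency —
# `ker(res : H¹(H, M) → H¹(H', M))` is killed by the exponent of the `φ`-coinvariants of `M^{H'}` when `φ` topologically
# generates `H` modulo `H'` — and its local forms at `v ∣ p` (crux `BDPSelmerLowerDivisibilityAtTwo`, stmt-BirchSwinnertonDyer-24728;
# route `TwoAdicConverse`, S3)

Helper file `--supports stmt-BirchSwinnertonDyer-24728` (cell `bsd-2adic`, seat `bsd-2adic-tower-1` GEN 54; key «COINVARIANT DOOR»,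
director-bsd (661), pen RC-654 §(2)–(3), SUMMON 20260830T195425Z). THEOREMS ONLY (no definition, no named fact, no instance,
no `sorry`). Sequel of GEN 53's `…AcLineSpecialisationAtTwoControl` (p783595), whose door reads ONE local hypothesis in the
INVARIANT currency, `hfixc` («`E[p^∞]^{I′}` has finite exponent», `I′ := pairKer κ₁ κ₂ ∩ I_{v̄}`) — false for CM curves and, for
non-CM curves, a Serre–Tate / Kummer statement the tree has no carrier for. What inflation–restriction actually CONSUMES is the
kernel of `res : H¹(H, A) → H¹(I′, A)` for `H := ker κ₂ ∩ D_{v̄}`, i.e. `H¹(H/I′, A^{I′})`; and on the habitat (β) the quotient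
`Q = H/I′` is PROCYCLIC (the `ℤ₂²`-extension `K̃_∞` is unramified over `K_∞^{(2)}` above `v̄`, so `I′ = ker κ₂ ∩ I_{v̄}` and
`Q ↪ D_{v̄}/I_{v̄} ≅ Ẑ`), topologically generated by a Frobenius lift `φ`, whence `ker(res) = A^{I′} ⧸ (φ − 1)A^{I′}` — the
COINVARIANTS, whose exponent is elementary (part II, `…AcLineOrdinaryShape`). This file is the generic algebra of that re-typing;
part I-b (`…AcLineCoinvariantControl`) runs the `ℤ_p²`-tower door on it.

* §1 ★ `nsmul_eq_zero_of_resOfLe_eq_zero_of_topGen` — INFLATION–RESTRICTION WITH EXPONENT, COINVARIANT FORM (generic: `H' ≤ H`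
  subgroups of a topological group `G`, `H' ⊴ G`, `M` discrete with continuous orbit maps): if `φ ∈ H` topologically generates
  `H` modulo `H'` (`H ≤ closure ⟨φ, H'⟩⁻`, Mathlib's `Subgroup.topologicalClosure`) and the `φ`-coinvariants of `M^{H'}` are
  killed by `n` (`∀ m ∈ M^{H'}, ∃ m' ∈ M^{H'}, n • m = φ • m' − m'`), then `ker(res : H¹(H, M) → H¹(H', M))` is killed by `n`.
  PROOF: for `z|_{H'} = δa`, `b(h) := z(h) − (h•a − a)` is `M^{H'}`-valued (GEN 53 §1's cocycle computation, isolated as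
  `smul_cocycle_sub_coboundary_eq`) and vanishes on `H'`; pick `m'` for `m := b(φ)`; the defect `f := n•b − δm'` satisfies the
  cocycle rule, vanishes at `φ` and on `H'`, so its zero set is a subgroup of `H` containing `⟨φ, H'⟩`; it is CLOSED (`M` discrete,
  `f` continuous) and closure in the subspace `H` is the trace of closure in `G` (`closure_subtype`), so `f = 0` on `H`.
  `coinv_of_fixed_nsmul_eq_zero`: GEN 53's `hfix` («`M^{H'}` killed by `n`») gives the coinvariant hypothesis with `m' := 0`.
* §2 the local forms at `v ∣ p` (`H ≤ H'` subgroups of `Γ_K`, `H ⊴ Γ_K`, any local datum `M⁺_v`, `φ ∈ H' ∩ D_v`, the generation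
  hypothesis spelled in `Γ_K` and TRANSPORTED into `D_v` by `decompIn_le_topologicalClosure`):
  `nsmul_mem_strictKer_of_resOfLe_mem_greenbergKer_of_topGen`, `…_strictDatum_…` (Castella's `M⁺_v = 0`).

HONEST LABELS: Galois-cohomological bookkeeping on CONSTRUCTED carriers; closes nothing at the ∀-level; the count of record of
O2 does not move (a door is not a discharge); U / R0G / ACPIN / OV16-print untouched; BSD is proved for no curve by any of this;
typed ≠ proved. References: Serre, *Local Fields* VII §6 Prop. 4 and XIII §1 (`H¹` of a procyclic group = coinvariants);
Neukirch–Schmidt–Wingberg (1.6.7), (1.7.7); Skinner–Urban, Invent. Math. 195 (2014) §3.2.7–3.2.8; Greenberg, LNM 1716 (1999)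
§3 Lemmas 3.1–3.3.
-/

-- D-0017: single-problem summit, the namespace repeats the problem name by design.
set_option linter.dupNamespace false
set_option autoImplicit false

noncomputable section

open scoped Classical

open NumberField IsDedekindDomain Field
open Literature.NumberTheory.EllipticCurves Literature.NumberTheory.GaloisRepresentations
  Literature.NumberTheory.EllipticCurves.GreenbergSelmer Literature.NumberTheory.EllipticCurves.GreenbergVatsal2000
  Literature.NumberTheory.EllipticCurves.Castella2018
open Summit.BirchSwinnertonDyer.BirchSwinnertonDyer.Theorems.TameExactControl

namespace Summit.BirchSwinnertonDyer.BirchSwinnertonDyer.Theorems.TwoAdicBDPAcLineSpec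

/-! ## §1. Inflation–restriction WITH EXPONENT, COINVARIANT form -/

section InfRes

universe u

variable {G : Type u} [Group G] [TopologicalSpace G] [IsTopologicalGroup G]
  {M : Type u} [AddCommGroup M] [DistribMulAction G M] [TopologicalSpace M] [DiscreteTopology M]

omit [IsTopologicalGroup G] in
/-- The cocycle computation of inflation–restriction, isolated (GEN 53 §1 `key`): for subgroups `H' ≤ H` of `G` with `H' ⊴ G`,
a continuous crossed homomorphism `z : H → M` with `z|_{H'} = δa`, and `h ∈ H`, the element `b(h) := z(h) − (h•a − a)` is
FIXED by `H'` — expand `z(x h) = z(h · h⁻¹xh)` both ways for `x ∈ H'`.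
[cite: SerreLocalFields1979, VII.§6 Prop. 4] [cite: NeukirchSchmidtWingberg2008, (1.6.7)] -/
theorem smul_cocycle_sub_coboundary_eq {H H' : Subgroup G} [hH' : H'.Normal] (hle : H' ≤ H)
    (z : contOneCocycles (discreteTopRep H M)) {a : M}
    (ha : ∀ x : H', z.1 (Subgroup.inclusion hle x) = (x : G) • a - a) (h : H) {x : G} (hx : x ∈ H') :
    x • (z.1 h - ((h : G) • a - a)) = z.1 h - ((h : G) • a - a) := by
  -- the two elements of `H` through which we expand the cocycle identity
  have hy : (h : G)⁻¹ * x * h ∈ H' := by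
    simpa only [inv_inv] using hH'.conj_mem x hx (h : G)⁻¹
  set xH : H := ⟨x, hle hx⟩ with hxH
  set yH : H := ⟨(h : G)⁻¹ * x * h, hle hy⟩ with hyH
  have hmul : xH * h = h * yH := Subtype.ext (by
    simp only [hxH, hyH, Subgroup.coe_mul, ← mul_assoc, mul_inv_cancel, one_mul])
  have hzx : z.1 xH = x • a - a := ha ⟨x, hx⟩
  have hzy : z.1 yH = ((h : G)⁻¹ * x * h) • a - a := ha ⟨(h : G)⁻¹ * x * h, hy⟩
  -- `z(xH · h) = z(xH) + x • z(h)` and `z(h · yH) = z(h) + h • z(yH)`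
  have e1 : z.1 (xH * h) = (x • a - a) + x • z.1 h := by
    rw [z.2 xH h, hzx]
    rfl
  have e2 : z.1 (xH * h) = z.1 h + ((x • ((h : G) • a)) - (h : G) • a) := by
    rw [hmul, z.2 h yH, hzy]
    change z.1 h + (h : G) • (((h : G)⁻¹ * x * h) • a - a) = _
    rw [smul_sub, smul_smul, ← mul_assoc, ← mul_assoc, mul_inv_cancel, one_mul, mul_smul]
  have e := eq_sub_of_add_eq' (e1.symm.trans e2)
  rw [smul_sub, smul_sub, e]
  abel

omit [TopologicalSpace G] [IsTopologicalGroup G] [TopologicalSpace M] [DiscreteTopology M] in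
/-- **The invariant currency implies the coinvariant currency** (bridge, so that every consumer of GEN 53's door is a consumer
of this one): if `M^{H'}` is KILLED by `n` then trivially every `H'`-fixed `m` has `n • m = φ • m' − m'` with the `H'`-fixed
`m' := 0`. [folklore] -/
theorem coinv_of_fixed_nsmul_eq_zero {H' : Subgroup G} {n : ℕ} (φ : G)
    (hfix : ∀ m : M, (∀ x ∈ H', x • m = m) → n • m = 0) (m : M) (hm : ∀ x ∈ H', x • m = m) :
    ∃ m' : M, (∀ x ∈ H', x • m' = m') ∧ n • m = φ • m' - m' :=
  ⟨0, fun x _ ↦ smul_zero x, by rw [hfix m hm, smul_zero, sub_zero]⟩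

/-- ★ **Inflation–restriction with exponent, COINVARIANT form.** Let `H' ≤ H` be subgroups of a topological group `G` with
`H'` normal in `G`, `M` a discrete `G`-module with continuous orbit maps, `φ ∈ H` an element which TOPOLOGICALLY GENERATES `H`
MODULO `H'` (`H ≤ closure ⟨φ, H'⟩⁻`), and suppose the `φ`-COINVARIANTS of `M^{H'}` are killed by `n`: every `H'`-fixed `m`
has `n • m = φ • m' − m'` for some `H'`-fixed `m'`. Then every class `c ∈ H¹(H, M)` with `res c = 0` in `H¹(H', M)` has
`n • c = 0`. (The kernel of `res` is `H¹(H/H', M^{H'})`; for `H/H'` procyclic on `φ` this is the coinvariant module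
`M^{H'}/(φ − 1)M^{H'}`.) On cocycles: `z|_{H'} = δa`; `b := z − δa` is `M^{H'}`-valued (`smul_cocycle_sub_coboundary_eq`) and
vanishes on `H'`; with `n • b(φ) = φ • m' − m'` the defect `f := n•z − δ(n•a + m')` is a continuous crossed homomorphism
vanishing at `φ` and on `H'`, so its zero set is a CLOSED subgroup of `H` containing `⟨φ, H'⟩`, i.e. all of `H`
(`closure_subtype`: closure in the subspace `H` is the trace of closure in `G`). GEN 53's `nsmul_eq_zero_of_resOfLe_eq_zero` is
the case `m' := 0` WITHOUT `hgen`. [cite: SerreLocalFields1979, VII.§6 Prop. 4 and XIII.§1] [cite: NeukirchSchmidtWingberg2008, (1.6.7), (1.7.7)]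
[cite: GreenbergLNM1716, §3 Lemma 3.1 (PDF p. 86)] -/
theorem nsmul_eq_zero_of_resOfLe_eq_zero_of_topGen {H H' : Subgroup G} [hH' : H'.Normal]
    (hle : H' ≤ H) (hcont : ∀ m : M, Continuous fun g : G ↦ g • m) {φ : G} (hφ : φ ∈ H)
    (hgen : H ≤ (Subgroup.closure ({φ} ∪ (H' : Set G))).topologicalClosure) {n : ℕ}
    (hcoinv : ∀ m : M, (∀ x ∈ H', x • m = m) →
      ∃ m' : M, (∀ x ∈ H', x • m' = m') ∧ n • m = φ • m' - m')
    {c : subgroupH1 H M} (hc : resOfLe M hle c = 0) : n • c = 0 := by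
  obtain ⟨z, rfl⟩ := oneCocycleClass_surjective _ c
  obtain ⟨a, ha⟩ := (CocycleCriteria.resOfLe_oneCocycleClass_eq_zero_iff hle z).mp hc
  -- `b(φ) = z(φ) − (φ•a − a)` is `H'`-fixed: choose an `H'`-fixed `m'` with `n • b(φ) = φ • m' − m'`
  obtain ⟨m', hm'fix, hm'⟩ := hcoinv (z.1 ⟨φ, hφ⟩ - (φ • a - a))
    (fun x hx ↦ smul_cocycle_sub_coboundary_eq hle z ha ⟨φ, hφ⟩ hx)
  rw [← oneCocycleClassₗ_apply, ← map_nsmul, oneCocycleClassₗ_apply, oneCocycleClass_eq_zero_iff]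
  refine ⟨n • a + m', fun h ↦ ?_⟩
  rw [Submodule.coe_smul_of_tower, ContinuousMap.smul_apply]
  change n • z.1 h = (h : G) • (n • a + m') - (n • a + m')
  -- the defect `f(h) := n • z(h) − (h • v − v)`, `v := n • a + m'`: a continuous crossed homomorphism on `H`
  let f : H → M := fun h ↦ n • z.1 h - ((h : G) • (n • a + m') - (n • a + m'))
  have hf1 : f 1 = 0 := by
    have hz1 : z.1 1 = 0 := contOneCocycles.apply_one z
    simp only [f, OneMemClass.coe_one, one_smul, sub_self, hz1, smul_zero]
  have hfmul : ∀ x y : H, f (x * y) = f x + (x : G) • f y := by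
    intro x y
    have hz : z.1 (x * y) = z.1 x + (x : G) • z.1 y := z.2 x y
    simp only [f]
    rw [hz, Subgroup.coe_mul, mul_smul, smul_add, smul_sub, smul_sub, smul_comm (x : G) n (z.1 y)]
    abel
  have hfinv : ∀ x : H, f x = 0 → f x⁻¹ = 0 := by
    intro x hx
    have h := hfmul x⁻¹ x
    rw [inv_mul_cancel, hf1, hx, smul_zero, add_zero] at h
    exact h.symm
  -- its zero set `Z ≤ H`
  let Z : Subgroup H :=
    { carrier := {x | f x = 0}
      one_mem' := hf1
      mul_mem' := fun {x y} hx hy ↦ by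
        simp only [Set.mem_setOf_eq] at hx hy ⊢
        rw [hfmul, hx, hy, smul_zero, add_zero]
      inv_mem' := fun {x} hx ↦ hfinv x hx }
  -- `Z` is closed: `M` is discrete and `f` is continuous (orbit maps continuous)
  have hfcont : Continuous f :=
    ((continuous_of_discreteTopology (f := fun m : M ↦ n • m)).comp z.1.continuous).sub
      (((hcont (n • a + m')).comp continuous_subtype_val).sub continuous_const)
  have hZclosed : IsClosed (Z : Set H) := (isClosed_discrete ({0} : Set M)).preimage hfcont
  -- `φ ∈ Z` (choice of `m'`) and `H' ≤ Z` (`z|_{H'} = δa`, `m'` is `H'`-fixed)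
  have hfφ : f ⟨φ, hφ⟩ = 0 := by
    change n • z.1 ⟨φ, hφ⟩ - (φ • (n • a + m') - (n • a + m')) = 0
    rw [smul_sub, sub_eq_iff_eq_add] at hm'
    rw [hm', smul_sub n (φ • a) a, smul_add φ (n • a) m', smul_comm φ n a]
    abel
  have hfH' : ∀ (x : G) (hx : x ∈ H'), f ⟨x, hle hx⟩ = 0 := by
    intro x hx
    change n • z.1 ⟨x, hle hx⟩ - (x • (n • a + m') - (n • a + m')) = 0
    have hzx : z.1 ⟨x, hle hx⟩ = x • a - a := ha ⟨x, hx⟩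
    rw [hzx, smul_add x (n • a) m', hm'fix x hx, smul_sub n (x • a) a, smul_comm x n a]
    abel
  have hleZ : Subgroup.closure ({φ} ∪ (H' : Set G)) ≤ Z.map H.subtype := by
    rw [Subgroup.closure_le]
    intro x hx
    rcases hx with hx | hx
    · rw [Set.mem_singleton_iff] at hx
      rw [hx]
      exact ⟨⟨φ, hφ⟩, hfφ, rfl⟩
    · exact ⟨⟨x, hle hx⟩, hfH' x hx, rfl⟩
  -- hence every `h ∈ H` lies in `Z`: closure in the subspace `H` is the trace of closure in `G`
  have hmem : h ∈ Z := by
    have h1 : (h : G) ∈ _root_.closure ((Z.map H.subtype : Subgroup G) : Set G) :=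
      Subgroup.topologicalClosure_mono hleZ (hgen h.2)
    rw [Subgroup.coe_map, Subgroup.coe_subtype] at h1
    have h2 : h ∈ _root_.closure (Z : Set H) := closure_subtype.mpr h1
    rwa [hZclosed.closure_eq] at h2
  have hfh : f h = 0 := hmem
  exact sub_eq_zero.mp hfh

end InfRes

/-! ## §2. The local forms at `v ∣ p`: Greenberg over `K̄^H` ⟹ `n •` STRICT over `K̄^{H'}` from the coinvariant exponent -/

section Strict

variable {K : Type} [Field K] [NumberField K]
  {M : Type} [AddCommGroup M] [DistribMulAction (absoluteGaloisGroup K) M] [TopologicalSpace M]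
  [DiscreteTopology M]

/-- Orbit maps of the decomposition group `D_v` on `M ⧸ M⁺_v` are continuous as soon as those of `Γ_K` on `M` are
(`δ • (m mod M⁺) = (δ • m) mod M⁺`, `LocalDatum.smul_grMk`; `M ⧸ M⁺_v` is discrete). [folklore] -/
theorem continuous_smul_gr {v : HeightOneSpectrum (𝓞 K)} (N : LocalDatum K M v)
    (hcont : ∀ m : M, Continuous fun g : absoluteGaloisGroup K ↦ g • m) (g : N.Gr) :
    Continuous fun x : decomp (K := K) v ↦ x • g := by
  obtain ⟨m, rfl⟩ := N.grMk_surjective g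
  have e : (fun x : decomp (K := K) v ↦ x • N.grMk m) =
      N.grMk ∘ (fun x : absoluteGaloisGroup K ↦ x • m) ∘ (Subtype.val : decomp (K := K) v → absoluteGaloisGroup K) := by
    ext x
    rw [LocalDatum.smul_grMk]
    rfl
  rw [e]
  exact continuous_of_discreteTopology.comp ((hcont m).comp continuous_subtype_val)

/-- **Transport of the generation hypothesis into `D_v`.** If `φ ∈ D_v` and `H' ∩ D_v ≤ closure ⟨φ, H ∩ I_v⟩⁻` in `Γ_K`, then
inside the decomposition group (subspace topology) `decompIn H' v ≤ closure ⟨φ, inertiaIn H v⟩⁻`: the abstract closure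
commutes with the inclusion `D_v ↪ Γ_K` (`MonoidHom.map_closure`; `I_v ≤ D_v`) and the topological closure in the subspace
is the trace of the closure in `Γ_K` (`closure_subtype`). [folklore] -/
theorem decompIn_le_topologicalClosure {H H' : Subgroup (absoluteGaloisGroup K)} {v : HeightOneSpectrum (𝓞 K)}
    {φ : absoluteGaloisGroup K} (hφ : φ ∈ decomp v)
    (hgen : H' ⊓ decomp v ≤ (Subgroup.closure
      ({φ} ∪ ((H ⊓ inertia v : Subgroup (absoluteGaloisGroup K)) : Set (absoluteGaloisGroup K)))).topologicalClosure) :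
    decompIn H' v ≤ (Subgroup.closure
      ({(⟨φ, hφ⟩ : decomp v)} ∪ (inertiaIn H v : Set (decomp (K := K) v)))).topologicalClosure := by
  intro x hx
  have hxH' : (x : absoluteGaloisGroup K) ∈ H' := (mem_decompIn_iff H' v x).1 hx
  have h1 : (x : absoluteGaloisGroup K) ∈ _root_.closure ((Subgroup.closure
      ({φ} ∪ ((H ⊓ inertia v : Subgroup (absoluteGaloisGroup K)) : Set (absoluteGaloisGroup K))) :
        Subgroup (absoluteGaloisGroup K)) : Set (absoluteGaloisGroup K)) :=
    hgen (Subgroup.mem_inf.2 ⟨hxH', x.2⟩)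
  -- the image of the small generating set is the large one
  have hset : (Subtype.val : decomp (K := K) v → absoluteGaloisGroup K) ''
      ({(⟨φ, hφ⟩ : decomp v)} ∪ (inertiaIn H v : Set (decomp (K := K) v))) =
        {φ} ∪ ((H ⊓ inertia v : Subgroup (absoluteGaloisGroup K)) : Set (absoluteGaloisGroup K)) := by
    ext y
    simp only [Set.mem_image, Set.mem_union, Set.mem_singleton_iff, SetLike.mem_coe, Subgroup.mem_inf,
      mem_inertiaIn_iff]
    constructor
    · rintro ⟨y', hy', rfl⟩
      rcases hy' with rfl | ⟨hyH, hyI⟩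
      · exact Or.inl rfl
      · exact Or.inr ⟨hyH, hyI⟩
    · rintro (hy | ⟨hyH, hyI⟩)
      · exact ⟨⟨φ, hφ⟩, Or.inl rfl, hy.symm⟩
      · exact ⟨⟨y, inertia_le_decomp v hyI⟩, Or.inr ⟨hyH, hyI⟩, rfl⟩
  have himg : (Subgroup.closure ({(⟨φ, hφ⟩ : decomp v)} ∪ (inertiaIn H v : Set (decomp (K := K) v)))).map
      (decomp (K := K) v).subtype = Subgroup.closure
        ({φ} ∪ ((H ⊓ inertia v : Subgroup (absoluteGaloisGroup K)) : Set (absoluteGaloisGroup K))) := by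
    rw [MonoidHom.map_closure, Subgroup.coe_subtype, hset]
  change x ∈ _root_.closure ((Subgroup.closure
    ({(⟨φ, hφ⟩ : decomp v)} ∪ (inertiaIn H v : Set (decomp (K := K) v)))) : Set (decomp (K := K) v))
  rw [closure_subtype, ← Subgroup.coe_subtype, ← Subgroup.coe_map, himg]
  exact h1

/-- **Greenberg over `K̄^H` ⟹ `n •` strict over `K̄^{H'}`, COINVARIANT form** (`H ≤ H'` subgroups of `Γ_K`, `H ⊴ Γ_K`, any
local datum `M⁺_v`, continuous orbits): let `φ ∈ H' ∩ D_v` topologically generate `H' ∩ D_v` modulo `H ∩ I_v`, and suppose the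
`φ`-coinvariants of `(M/M⁺_v)^{H ∩ I_v}` are killed by `n`. If the restriction `res y ∈ H¹(H, M)` of `y ∈ H¹(H', M)` satisfies
Greenberg's inertia condition at `v`, then `n • y` satisfies the STRICT condition at `v` (§1 inside `D_v`; `H ∩ I_v ⊴ D_v`,
`SignedEC.SharpEigen.inertiaIn_normal`). GEN 53's `nsmul_mem_strictKer_of_resOfLe_mem_greenbergKer` is the invariant currency.
[cite: SkinnerUrban2014, Prop. 3.2.8 (p. 23)] [cite: GreenbergLNM1716, §3 Lemma 3.1, Lemma 3.3] [cite: SerreLocalFields1979, VII §6 Prop. 4, XIII §1] -/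
theorem nsmul_mem_strictKer_of_resOfLe_mem_greenbergKer_of_topGen {H H' : Subgroup (absoluteGaloisGroup K)} [H.Normal]
    (hle : H ≤ H') {v : HeightOneSpectrum (𝓞 K)} (N : LocalDatum K M v)
    (hcont : ∀ m : M, Continuous fun g : absoluteGaloisGroup K ↦ g • m)
    {φ : absoluteGaloisGroup K} (hφ : φ ∈ H' ⊓ decomp v)
    (hgen : H' ⊓ decomp v ≤ (Subgroup.closure
      ({φ} ∪ ((H ⊓ inertia v : Subgroup (absoluteGaloisGroup K)) : Set (absoluteGaloisGroup K)))).topologicalClosure)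
    {n : ℕ}
    (hcoinv : ∀ g : N.Gr, (∀ x : decomp (K := K) v, x ∈ inertiaIn H v → x • g = g) →
      ∃ g' : N.Gr, (∀ x : decomp (K := K) v, x ∈ inertiaIn H v → x • g' = g') ∧
        n • g = (⟨φ, (Subgroup.mem_inf.1 hφ).2⟩ : decomp v) • g' - g')
    {y : subgroupH1 H' M} (h : resOfLe M hle y ∈ N.greenbergKer H) : n • y ∈ N.strictKer H' := by
  haveI : (inertiaIn H v).Normal := SignedEC.SharpEigen.inertiaIn_normal H v
  have hι : inertiaIn H v ≤ decompIn H' v := (inertiaIn_le_decompIn H v).trans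
    (fun x hx ↦ (mem_decompIn_iff H' v x).2 (hle ((mem_decompIn_iff H v x).1 hx)))
  rw [LocalDatum.mem_strictKer_iff, map_nsmul]
  refine nsmul_eq_zero_of_resOfLe_eq_zero_of_topGen (M := N.Gr) hι (continuous_smul_gr N hcont)
    ((mem_decompIn_iff H' v _).2 (Subgroup.mem_inf.1 hφ).1)
    (decompIn_le_topologicalClosure (Subgroup.mem_inf.1 hφ).2 hgen) hcoinv ?_
  rw [resOfLe_strictMap_eq_greenbergMap_resOfLe hle N y]
  exact (LocalDatum.mem_greenbergKer_iff H N _).1 h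

/-- The case `M⁺_v = 0` (Castella's STRICT datum), COINVARIANT form, everything spelled in `Γ_K` and `M`: `φ ∈ H' ∩ D_v`
topologically generates `H' ∩ D_v` modulo `H ∩ I_v`, and the `φ`-coinvariants of `M^{H ∩ I_v}` are killed by `n` (every
`H ∩ I_v`-fixed `m` has `n • m = φ • m' − m'` with `m'` fixed). Then Greenberg's inertia condition for `res y` over `K̄^H`
implies the strict condition for `n • y` over `K̄^{H'}`. GEN 53's `nsmul_mem_strictKer_strictDatum_of_resOfLe_mem_greenbergKer`
is the invariant currency (`m' := 0`). [cite: SkinnerUrban2014, Prop. 3.2.8 (p. 23)] [cite: Castella2018, Def. 2.2 (arXiv:1704.06608 p. 5)]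
[cite: SerreLocalFields1979, XIII §1] -/
theorem nsmul_mem_strictKer_strictDatum_of_resOfLe_mem_greenbergKer_of_topGen
    {H H' : Subgroup (absoluteGaloisGroup K)} [H.Normal] (hle : H ≤ H') (v : HeightOneSpectrum (𝓞 K))
    (hcont : ∀ m : M, Continuous fun g : absoluteGaloisGroup K ↦ g • m)
    {φ : absoluteGaloisGroup K} (hφ : φ ∈ H' ⊓ decomp v)
    (hgen : H' ⊓ decomp v ≤ (Subgroup.closure
      ({φ} ∪ ((H ⊓ inertia v : Subgroup (absoluteGaloisGroup K)) : Set (absoluteGaloisGroup K)))).topologicalClosure)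
    {n : ℕ}
    (hcoinv : ∀ m : M, (∀ x : absoluteGaloisGroup K, x ∈ H → x ∈ inertia v → x • m = m) →
      ∃ m' : M, (∀ x : absoluteGaloisGroup K, x ∈ H → x ∈ inertia v → x • m' = m') ∧ n • m = φ • m' - m')
    {y : subgroupH1 H' M} (h : resOfLe M hle y ∈ (AcSelmer.strictDatum M v).greenbergKer H) :
    n • y ∈ (AcSelmer.strictDatum M v).strictKer H' := by
  refine nsmul_mem_strictKer_of_resOfLe_mem_greenbergKer_of_topGen hle _ hcont hφ hgen (fun g hg ↦ ?_) h
  obtain ⟨m, rfl⟩ := (AcSelmer.strictDatum M v).grMk_surjective g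
  -- `M⁺ = 0`: the class of `m` is fixed iff `m` is
  have hm : ∀ x : absoluteGaloisGroup K, x ∈ H → x ∈ inertia v → x • m = m := by
    intro x hxH hxI
    have hxD : x ∈ decomp (K := K) v := inertia_le_decomp v hxI
    have h1 := hg ⟨x, hxD⟩ ((mem_inertiaIn_iff H v _).2 ⟨hxH, hxI⟩)
    rw [LocalDatum.smul_grMk, ← sub_eq_zero, ← map_sub, ← AddMonoidHom.mem_ker, LocalDatum.ker_grMk] at h1
    change x • m - m ∈ (⊥ : AddSubgroup M) at h1
    rw [AddSubgroup.mem_bot, sub_eq_zero] at h1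
    exact h1
  obtain ⟨m', hm'fix, hm'⟩ := hcoinv m hm
  refine ⟨(AcSelmer.strictDatum M v).grMk m', fun x hx ↦ ?_, ?_⟩
  · obtain ⟨hxH, hxI⟩ := (mem_inertiaIn_iff H v x).1 hx
    rw [LocalDatum.smul_grMk, hm'fix x hxH hxI]
  · rw [← map_nsmul, hm', LocalDatum.smul_grMk, map_sub]

end Strict

end Summit.BirchSwinnertonDyer.BirchSwinnertonDyer.Theorems.TwoAdicBDPAcLineSpec

end
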